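import Summits.MatrixMultiplication.OmegaCensus.SmallFormats.MatMul22nFrameTypeFCount
import HarnessLib

/-!
# ω-census family (a): Alekseev frames at length `3m + 3`, part 1 — Lemma 11 at parameters `(2m, ≤ m+3)`, `m ≥ 8` (any field)

Cell `pub-omega` (unit `pub-omega-tensor`, gen 38), topic `Summits/MatrixMultiplication/OmegaCensus` (sub-folder
`SmallFormats`). Framing (verbatim): lottery ticket; floor = certified bounds/negative ranges. HONEST FRAMING: a structural
theorem about bilinear algorithms for `⟨m,2,2⟩` (equivalently `⟨2,2,m⟩`) of length `3m + 3` over an ARBITRARY field, one step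
beyond the printed frame analysis (Alekseev 2015, Lemma 7: no solution of Problem `P` with parameters `(2m, m+2)`, `m ≥ 5`;
tree: `Alekseev2015.Frame.stepD_two`, p703299). It is NEW mathematics of the cell, not a cited result, and it is NOT a bound on
any rank by itself. Nothing here is a bound on `ω`.

This is part 1 of two files; part 2 (`MatMulM22Length3m3Frames.lean`) has `stepD_three` (no frame with `|I| = 2m`,
`|J| ≤ m + 3`, `m ≥ 8`), the parameter corollaries and the census clause (rows/columns cap `4` at length `3m + 3`).
Dictionary as in `Literature/…/MatMulM22RankLowerBoundProofs.lean`: computation `xy = ∑_t f_t(x) g_t(y) w_t` of `⟨m,2,2⟩`,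
frame `F` = maximal independent subfamily `I` of the first blocks `D_t^1 = f_t ⊗ p_t`, `J = Iᶜ`, `R1 ⊆ J` the indices with
`rank N_t ≤ 1` ("rank-two" = `∉ R1`, such indices have `p_t ≠ 0`, i.e. are of type G).

* `Frame3m3.sameClass_dichotomy` — the engine: if `|I| = 2m`, `|J| ≤ m + 3`, `m ≥ 7`, and two distinct rank-two indices
  `t_a, t_b ∈ J` lie in one class of rows (`p_{t_b} ∥ p_{t_a}`), then (B1) no third type-G index of `J` lies in that class, and
  (B2) all rank-two indices of `J ∖ {t_a, t_b}` lie in ONE class (Alekseev's Lemma 11 argument with one dimension of slack;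
  details in the theorem's docstring).
* `Frame3m3.false_of_sameClass_three` — **Lemma 11 at `(2m, ≤ m+3)`, `m ≥ 8`**: two distinct rank-two indices of `J` are never
  in one class (apply the dichotomy twice: (B2) puts the `≥ m − 5 ≥ 3` rank-two indices of `J ∖ {t₁,t₂}` in one class `T*`, and
  (B1) for two of them is contradicted by the third).

Calibration (desk `frameprobe.py`): `(2m, m+3)` frames DO occur at `m = 5, 6` (`⟨2,2,5⟩:18`, three Strassen blocks at
`(6,21)`), so `m ≥ 8` is used essentially (`m ≥ 7` in the dichotomy, `m − 5 ≥ 3` in Lemma 11).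
-/

namespace Summit.MatrixMultiplication.OmegaCensus.SmallFormats

open Finset Matrix Module
open Literature.Computability.AlgebraicComplexity
open Literature.Computability.AlgebraicComplexity.Alekseev2015

namespace Frame3m3

variable {k : Type*} [Field k] {m : ℕ} {ι : Type*} [Fintype ι] [DecidableEq ι]
variable {β : BilinComp (mulBilin k m 2 2) ι} (F : Frame β) (hI : F.I.card = 2 * m)

/-- Proportionality of non-zero vectors is symmetric. -/
private theorem par_symm {p q : Fin 2 → k} (hq : q ≠ 0) (h : ∃ a : k, q = a • p) : ∃ b : k, p = b • q := by
  obtain ⟨a, ha⟩ := h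
  have hane : a ≠ 0 := by rintro rfl; exact hq (by rw [ha, zero_smul])
  exact ⟨a⁻¹, by rw [ha, smul_smul, inv_mul_cancel₀ hane, one_smul]⟩
/-- Proportionality is transitive. -/
private theorem par_trans {p q r : Fin 2 → k} (h1 : ∃ a : k, q = a • p) (h2 : ∃ b : k, r = b • q) :
    ∃ c : k, r = c • p := by
  obtain ⟨a, ha⟩ := h1; obtain ⟨b, hb⟩ := h2; exact ⟨b * a, by rw [hb, ha, smul_smul]⟩

/-- Expansion in the dual basis: `x = ∑_j f_j(x) x_j` (the Literature file's lemma is private; restated for the cell's files). -/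
theorem expand₃ (x : Matrix (Fin m) (Fin 2) k) : x = ∑ j : ↥F.I, β.f j x • F.xd hI j := by
  rw [← sub_eq_zero, ← Module.forall_dual_apply_eq_zero_iff k]
  intro φ
  rw [← (F.basisF hI).sum_repr φ]
  simp only [LinearMap.coe_sum, Finset.sum_apply]
  refine Finset.sum_eq_zero fun t _ => ?_
  rw [LinearMap.smul_apply, Frame.basisF_apply, map_sub, map_sum]
  simp only [map_smul, Frame.f_xd, smul_eq_mul, mul_ite, mul_one, mul_zero, Finset.sum_ite_eq,
    Finset.mem_univ, if_true, sub_self]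

/-- A linear map is determined on the dual basis: values in a subspace (the Literature file's lemma is private; restated). -/
theorem map_mem_of_xd_mem₃ (N : Blk k m) (P : Submodule k (Fin 2 → k))
    (h : ∀ j : ↥F.I, N (F.xd hI j) ∈ P) (x : Matrix (Fin m) (Fin 2) k) : N x ∈ P := by
  rw [expand₃ F hI x, map_sum]
  exact Submodule.sum_mem _ fun j _ => by rw [map_smul]; exact Submodule.smul_mem _ _ (h j)

/-- `s = |R1| ≤ 2|J| − 2m` (the column count), in the form `|R1| ≤ 6` when `|J| ≤ m + 3`. -/
theorem card_R1_le_six (hJ : F.J.card ≤ m + 3) : F.R1.card ≤ 6 := by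
  have hcol := F.colCount
  have hsd : (F.J \ F.R1).card = F.J.card - F.R1.card := card_sdiff_of_subset F.R1_subset
  have hR1le : F.R1.card ≤ F.J.card := card_le_card F.R1_subset
  omega

include hI in
/-- **The dichotomy behind Lemma 11 at `(2m, ≤ m+3)`, `m ≥ 7`.** Let `t_a ≠ t_b` be rank-two indices of `J` in one class
(`p_{t_b} ∥ p_{t_a}`). Then (B1) no other index `t ∈ J` with `p_t ≠ 0` lies in that class, and (B2) any two rank-two indices of
`J ∖ {t_a, t_b}` lie in one class. (The case "the restricted `N_t` span only the `m`-space of the restricted `P_i`" is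
contradictory for `m ≥ 7`; in the other case the `m + 1` restricted `N_t` are non-zero and any two rank-two indices of different
classes would both be forced to have rank one.) -/
theorem sameClass_dichotomy (hm : 7 ≤ m) (hJ : F.J.card ≤ m + 3) {ta tb : ι} (ha : ta ∈ F.J) (hb : tb ∈ F.J)
    (hne : ta ≠ tb) (hra : ta ∉ F.R1) (hrb : tb ∉ F.R1) (hpar : ∃ a : k, pvec β tb = a • pvec β ta) :
    (∀ t ∈ F.J, t ≠ ta → t ≠ tb → pvec β t ≠ 0 → (∃ a : k, pvec β t = a • pvec β ta) → False) ∧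
    (∀ t ∈ F.J \ {ta, tb}, ∀ t' ∈ F.J \ {ta, tb}, t ∉ F.R1 → t' ∉ F.R1 →
      ∃ a : k, pvec β t' = a • pvec β t) := by
  classical
  have hpa : pvec β ta ≠ 0 := F.pvec_ne_zero_of_not_mem_R1 ha hra
  have hpb : pvec β tb ≠ 0 := F.pvec_ne_zero_of_not_mem_R1 hb hrb
  obtain ⟨a12, ha12⟩ := hpar
  have hs6 := card_R1_le_six F hJ
  -- the rows of the other classes
  let U : Submodule k (Matrix (Fin m) (Fin 2) k) :=
    Submodule.span k (Set.range fun j : {j : ↥F.I // ¬ ∃ a : k, pvec β j = a • pvec β ta} =>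
      F.xd hI j.1)
  let Res : Blk k m →ₗ[k] (↥U →ₗ[k] (Fin 2 → k)) := LinearMap.lcomp k (Fin 2 → k) U.subtype
  have hRes : ∀ (N : Blk k m), (∀ j : ↥F.I, (¬ ∃ a : k, pvec β j = a • pvec β ta) →
      N (F.xd hI j) = 0) → Res N = 0 := by
    intro N hN
    apply LinearMap.ext
    intro u
    have hU : U ≤ LinearMap.ker N := by
      refine Submodule.span_le.mpr ?_
      rintro _ ⟨j, rfl⟩
      exact hN j.1 j.2
    simpa [Res] using hU u.2
  have hResval : ∀ (N : Blk k m) (j : ↥F.I) (hj : ¬ ∃ a : k, pvec β j = a • pvec β ta),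
      Res N ⟨F.xd hI j, Submodule.subset_span ⟨⟨j, hj⟩, rfl⟩⟩ = N (F.xd hI j) := by
    intro N j hj
    simp [Res]
  -- a type-G index of the class of `ta` restricts to zero (Lemma 10)
  have hRes0 : ∀ t ∈ F.J, pvec β t ≠ 0 → (∃ a : k, pvec β t = a • pvec β ta) → Res (F.N2 t) = 0 := by
    intro t ht hpt hcl
    refine hRes _ fun j hj => by_contra fun hne0 => hj ?_
    exact par_trans hcl (F.par_of_N2_xd_ne_zero hI (F.mem_J.1 ht) hpt j hne0)
  have hRa : Res (F.N2 ta) = 0 := hRes0 ta ha hpa ⟨1, by rw [one_smul]⟩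
  have hRb : Res (F.N2 tb) = 0 := hRes0 tb hb hpb ⟨a12, ha12⟩
  -- K and the spans
  let K : Finset ι := F.J \ {ta, tb}
  have hsub : ({ta, tb} : Finset ι) ⊆ F.J := by
    intro t ht
    rcases Finset.mem_insert.1 ht with rfl | ht
    · exact ha
    · rwa [Finset.mem_singleton.1 ht]
  have hKcard : K.card = F.J.card - 2 := by
    rw [Finset.card_sdiff_of_subset hsub, Finset.card_pair hne]
  have hKJ : ∀ t ∈ K, t ∈ F.J := fun t ht => (Finset.mem_sdiff.1 ht).1
  let SN : Submodule k (↥U →ₗ[k] (Fin 2 → k)) :=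
    Submodule.span k (↑(K.image fun t => Res (F.N2 t)) : Set (↥U →ₗ[k] (Fin 2 → k)))
  have hmemSN : ∀ t ∈ K, Res (F.N2 t) ∈ SN := fun t ht =>
    Submodule.subset_span (by rw [Finset.coe_image]; exact ⟨t, by simpa using ht, rfl⟩)
  have hmem : ∀ i, Res (rowMap k m i) ∈ SN := by
    intro i
    rw [F.rowMap_eq_sum_N2 i, map_sum]
    refine Submodule.sum_mem _ fun t ht => ?_
    rw [map_smul]
    refine Submodule.smul_mem _ _ ?_
    by_cases hK : t ∈ K
    · exact hmemSN t hK
    · have hor : t = ta ∨ t = tb := by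
        by_contra hh
        obtain ⟨h1', h2'⟩ := not_or.mp hh
        exact hK (Finset.mem_sdiff.2 ⟨ht, by simp [h1', h2']⟩)
      rcases hor with rfl | rfl
      · rw [hRa]; exact Submodule.zero_mem _
      · rw [hRb]; exact Submodule.zero_mem _
  -- the restricted P_i are independent (Lemma 9)
  have hli : LinearIndependent k fun i => Res (rowMap k m i) := by
    rw [Fintype.linearIndependent_iff]
    intro c hc
    have hc' : Res (∑ i, c i • rowMap k m i) = 0 := by
      rw [map_sum]
      simpa [map_smul] using hc
    have hzero := F.eq_zero_of_vanish hI (pvec β ta) c fun j hj => by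
      have hxU : F.xd hI j ∈ U := Submodule.subset_span ⟨⟨j, hj⟩, rfl⟩
      have := LinearMap.congr_fun hc' ⟨F.xd hI j, hxU⟩
      simpa [Res] using this
    exact fun i => congrFun hzero i
  let SP : Submodule k (↥U →ₗ[k] (Fin 2 → k)) :=
    Submodule.span k (Set.range fun i => Res (rowMap k m i))
  have hdimP : finrank k SP = m := by
    simp only [SP]
    rw [finrank_span_eq_card hli, Fintype.card_fin]
  have hPN : SP ≤ SN := Submodule.span_le.mpr (by rintro _ ⟨i, rfl⟩; exact hmem i)
  have hdimN : finrank k SN ≤ K.card :=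
    (finrank_span_finset_le_card (R := k) (K.image fun t => Res (F.N2 t))).trans Finset.card_image_le
  -- a combination of the P_i evaluated at x_j lies on k p_j (Lemma 8)
  have hSPval : ∀ σ ∈ SP, ∀ (j : ↥F.I) (hj : ¬ ∃ a : k, pvec β j = a • pvec β ta),
      σ ⟨F.xd hI j, Submodule.subset_span ⟨⟨j, hj⟩, rfl⟩⟩ ∈ Submodule.span k ({pvec β j} : Set (Fin 2 → k)) := by
    intro σ hσ j hj
    obtain ⟨c, hc⟩ := (Submodule.mem_span_range_iff_exists_fun k).1 hσ
    rw [← hc]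
    have hs := F.sum_rowMap_xd hI c j
    simp only [LinearMap.coe_sum, Finset.sum_apply, LinearMap.smul_apply] at hs
    simp only [LinearMap.coe_sum, Finset.sum_apply, LinearMap.smul_apply, Res, LinearMap.lcomp_apply',
      Submodule.subtype_apply, LinearMap.comp_apply]
    rw [hs]
    exact Submodule.smul_mem _ _ (Submodule.mem_span_singleton_self _)
  -- type-G indices outside the class of ta whose restriction is a combination of the restricted P_i have rank one
  have hG1 : ∀ t ∈ K, pvec β t ≠ 0 → (¬ ∃ c : k, pvec β t = c • pvec β ta) → Res (F.N2 t) ∈ SP →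
      RankLEOne (F.N2 t) := by
    intro t ht hpt hnpar hcomb
    have htI : t ∉ F.I := F.mem_J.1 (hKJ t ht)
    refine rankLEOne_of_forall_mem_span _ (pvec β t) (map_mem_of_xd_mem₃ F hI _ _ fun j => ?_)
    by_cases hz : F.N2 t (F.xd hI j) = 0
    · rw [hz]; exact Submodule.zero_mem _
    · obtain ⟨a', ha'⟩ := F.par_of_N2_xd_ne_zero hI htI hpt j hz
      have hj : ¬ ∃ c : k, pvec β j = c • pvec β ta := by
        intro hc
        exact hnpar (par_trans hc (par_symm (F.pvec_ne_zero j.2) ⟨a', ha'⟩))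
      have hval := hSPval _ hcomb j hj
      rw [hResval (F.N2 t) j hj] at hval
      obtain ⟨b, hb⟩ := Submodule.mem_span_singleton.1 hval
      rw [← hb, ha', smul_smul]
      exact Submodule.smul_mem _ _ (Submodule.mem_span_singleton_self _)
  by_cases hA : SP = SN
  · -- Case A: every rank-two N_t is supported on the class of ta, so the restricted P_i lie in the span of the
    -- at most six rank-one restrictions: m ≤ 6.
    exfalso
    have hzero : ∀ t ∈ F.J, t ∉ F.R1 → Res (F.N2 t) = 0 := by
      intro t ht hR
      have hpt : pvec β t ≠ 0 := F.pvec_ne_zero_of_not_mem_R1 ht hR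
      by_cases hK : t ∈ K
      · by_cases hcl : ∃ c : k, pvec β t = c • pvec β ta
        · exact hRes0 t ht hpt hcl
        · exfalso
          have hcomb : Res (F.N2 t) ∈ SP := by rw [hA]; exact hmemSN t hK
          exact hR (F.mem_R1.2 ⟨ht, hG1 t hK hpt hcl hcomb⟩)
      · have hor : t = ta ∨ t = tb := by
          by_contra hh
          obtain ⟨h1', h2'⟩ := not_or.mp hh
          exact hK (Finset.mem_sdiff.2 ⟨ht, by simp [h1', h2']⟩)
        rcases hor with rfl | rfl
        · exact hRa
        · exact hRb
    let S1 : Submodule k (↥U →ₗ[k] (Fin 2 → k)) :=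
      Submodule.span k (↑(F.R1.image fun t => Res (F.N2 t)) : Set (↥U →ₗ[k] (Fin 2 → k)))
    have hPS1 : SP ≤ S1 := by
      refine Submodule.span_le.mpr ?_
      rintro _ ⟨i, rfl⟩
      show Res (rowMap k m i) ∈ S1
      rw [F.rowMap_eq_sum_N2 i, map_sum]
      refine Submodule.sum_mem _ fun t ht => ?_
      rw [map_smul]
      refine Submodule.smul_mem _ _ ?_
      by_cases hR : t ∈ F.R1
      · exact Submodule.subset_span (by rw [Finset.coe_image]; exact ⟨t, by simpa using hR, rfl⟩)
      · rw [hzero t ht hR]; exact Submodule.zero_mem _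
    have h1 := Submodule.finrank_mono hPS1
    have h2 : finrank k S1 ≤ F.R1.card :=
      (finrank_span_finset_le_card (R := k) (F.R1.image fun t => Res (F.N2 t))).trans Finset.card_image_le
    rw [hdimP] at h1
    omega
  · -- Case B: dim SN = m + 1 = |K|.
    have hdimN' : finrank k SN = m + 1 := by
      have h1 : ¬ finrank k SN ≤ finrank k SP := fun h => hA (Submodule.eq_of_le_of_finrank_le hPN h)
      rw [hdimP] at h1
      omega
    have hKm : K.card = m + 1 := by omega
    -- every restricted N_t, t ∈ K, is non-zero
    have hRne : ∀ t ∈ K, Res (F.N2 t) ≠ 0 := by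
      intro t ht h0
      have hle : SN ≤ Submodule.span k
          (↑((K.erase t).image fun t' => Res (F.N2 t')) : Set (↥U →ₗ[k] (Fin 2 → k))) := by
        refine Submodule.span_le.mpr ?_
        intro v hv
        rw [Finset.coe_image] at hv
        obtain ⟨t', ht', rfl⟩ := hv
        show Res (F.N2 t') ∈ _
        by_cases htt : t' = t
        · rw [htt, h0]; exact Submodule.zero_mem _
        · refine Submodule.subset_span ?_
          rw [Finset.coe_image]
          exact ⟨t', Finset.mem_erase.2 ⟨htt, ht'⟩, rfl⟩
      have h3 := Submodule.finrank_mono hle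
      have h4 : finrank k (Submodule.span k
          (↑((K.erase t).image fun t' => Res (F.N2 t')) : Set (↥U →ₗ[k] (Fin 2 → k)))) ≤
          (K.erase t).card :=
        (finrank_span_finset_le_card (R := k) ((K.erase t).image fun t' => Res (F.N2 t'))).trans
          Finset.card_image_le
      rw [Finset.card_erase_of_mem ht] at h4
      omega
    -- (B1): no type-G index of K lies in the class of ta
    have hB1 : ∀ t ∈ F.J, t ≠ ta → t ≠ tb → pvec β t ≠ 0 →
        (∃ a : k, pvec β t = a • pvec β ta) → False := by
      intro t ht h1 h2 hpt hcl
      have hK : t ∈ K := Finset.mem_sdiff.2 ⟨ht, by simp [h1, h2]⟩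
      exact hRne t hK (hRes0 t ht hpt hcl)
    -- two elements of SN outside SP: N_{t'} ≡ a N_t mod SP with a ≠ 0
    have hpairSP : ∀ t ∈ K, ∀ t' ∈ K, Res (F.N2 t) ∉ SP → Res (F.N2 t') ∉ SP →
        ∃ σ ∈ SP, ∃ a : k, a ≠ 0 ∧ Res (F.N2 t') = σ + a • Res (F.N2 t) := by
      intro t ht t' ht' hn hn'
      let L : Submodule k (↥U →ₗ[k] (Fin 2 → k)) := SP ⊔ Submodule.span k {Res (F.N2 t)}
      have hLN : L ≤ SN := sup_le hPN (Submodule.span_le.mpr (by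
        rintro _ ⟨rfl⟩; exact hmemSN t ht))
      have hPL : SP ≤ L := le_sup_left
      have hLeq : L = SN := by
        apply Submodule.eq_of_le_of_finrank_le hLN
        have h1 : ¬ finrank k L ≤ finrank k SP := by
          intro h
          have := Submodule.eq_of_le_of_finrank_le hPL h
          apply hn
          rw [this]
          exact Submodule.mem_sup_right (Submodule.mem_span_singleton_self _)
        rw [hdimP] at h1
        rw [hdimN']
        omega
      have hmemL : Res (F.N2 t') ∈ L := by rw [hLeq]; exact hmemSN t' ht'
      obtain ⟨σ, hσ, z, hz, hsum⟩ := Submodule.mem_sup.1 hmemL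
      obtain ⟨a, rfl⟩ := Submodule.mem_span_singleton.1 hz
      refine ⟨σ, hσ, a, ?_, by rw [hsum]⟩
      rintro rfl
      apply hn'
      rw [← hsum, zero_smul, add_zero]
      exact hσ
    -- (B-ii): two type-G indices of K outside SP with different classes: the first has rank one
    have hBii : ∀ t ∈ K, ∀ t' ∈ K, pvec β t ≠ 0 → pvec β t' ≠ 0 → Res (F.N2 t) ∉ SP → Res (F.N2 t') ∉ SP →
        (¬ ∃ c : k, pvec β t' = c • pvec β t) → RankLEOne (F.N2 t) := by
      intro t ht t' ht' hpt hpt' hn hn' hcl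
      have htI : t ∉ F.I := F.mem_J.1 (hKJ t ht)
      have htI' : t' ∉ F.I := F.mem_J.1 (hKJ t' ht')
      -- the class of t is not the class of ta
      have hnta : ¬ ∃ c : k, pvec β t = c • pvec β ta := by
        intro hc; exact hn (by rw [hRes0 t (hKJ t ht) hpt hc]; exact Submodule.zero_mem _)
      obtain ⟨σ, hσ, a, hane, hsum⟩ := hpairSP t ht t' ht' hn hn'
      refine rankLEOne_of_forall_mem_span _ (pvec β t) (map_mem_of_xd_mem₃ F hI _ _ fun j => ?_)
      by_cases hz : F.N2 t (F.xd hI j) = 0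
      · rw [hz]; exact Submodule.zero_mem _
      · obtain ⟨a', ha'⟩ := F.par_of_N2_xd_ne_zero hI htI hpt j hz
        -- p_j ∥ p_t, so x_j ∈ U and N_{t'}(x_j) = 0
        have hj : ¬ ∃ c : k, pvec β j = c • pvec β ta := by
          intro hc
          exact hnta (par_trans hc (par_symm (F.pvec_ne_zero j.2) ⟨a', ha'⟩))
        have hz' : F.N2 t' (F.xd hI j) = 0 := by
          by_contra hne0
          obtain ⟨b', hb'⟩ := F.par_of_N2_xd_ne_zero hI htI' hpt' j hne0
          exact hcl (par_trans ⟨a', ha'⟩ (par_symm (F.pvec_ne_zero j.2) ⟨b', hb'⟩))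
        have hval := LinearMap.congr_fun hsum ⟨F.xd hI j, Submodule.subset_span ⟨⟨j, hj⟩, rfl⟩⟩
        rw [LinearMap.add_apply, LinearMap.smul_apply, hResval (F.N2 t') j hj, hResval (F.N2 t) j hj, hz'] at hval
        have hσval := hSPval σ hσ j hj
        obtain ⟨b, hb⟩ := Submodule.mem_span_singleton.1 hσval
        -- a • N_t(x_j) = -σ(x_j) ∈ k p_j ⊆ k p_t
        have hNt : F.N2 t (F.xd hI j) = (a⁻¹ * (-b * a')) • pvec β t := by
          have h1 : a • F.N2 t (F.xd hI j) = -(b • pvec β j) := by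
            rw [hb]; exact eq_neg_of_add_eq_zero_right hval.symm
          rw [mul_smul, ← smul_smul, ← ha', neg_smul, ← h1, smul_smul, inv_mul_cancel₀ hane, one_smul]
        rw [hNt]
        exact Submodule.smul_mem _ _ (Submodule.mem_span_singleton_self _)
    refine ⟨hB1, ?_⟩
    -- (B2)
    intro t ht t' ht' hR hR'
    have htJ : t ∈ F.J := hKJ t ht
    have htJ' : t' ∈ F.J := hKJ t' ht'
    have hpt : pvec β t ≠ 0 := F.pvec_ne_zero_of_not_mem_R1 htJ hR
    have hpt' : pvec β t' ≠ 0 := F.pvec_ne_zero_of_not_mem_R1 htJ' hR'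
    by_contra hcl
    have hne' : t ≠ ta ∧ t ≠ tb := by simpa [K, Finset.mem_sdiff, htJ] using ht
    have hne'' : t' ≠ ta ∧ t' ≠ tb := by simpa [K, Finset.mem_sdiff, htJ'] using ht'
    -- neither restriction lies in SP
    have hn : Res (F.N2 t) ∉ SP := by
      intro hin
      have hnta : ¬ ∃ c : k, pvec β t = c • pvec β ta := fun hc => hB1 t htJ hne'.1 hne'.2 hpt hc
      exact hR (F.mem_R1.2 ⟨htJ, hG1 t ht hpt hnta hin⟩)
    have hn' : Res (F.N2 t') ∉ SP := by
      intro hin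
      have hnta : ¬ ∃ c : k, pvec β t' = c • pvec β ta := fun hc => hB1 t' htJ' hne''.1 hne''.2 hpt' hc
      exact hR' (F.mem_R1.2 ⟨htJ', hG1 t' ht' hpt' hnta hin⟩)
    exact hR (F.mem_R1.2 ⟨htJ, hBii t ht t' ht' hpt hpt' hn hn' hcl⟩)

include hI in
/-- **Lemma 11 at parameters `(2m, ≤ m+3)`, `m ≥ 8`**: two distinct rank-two indices of `J` never lie in one class of rows.
(The dichotomy for `t₁, t₂` puts the `≥ m − 5 ≥ 3` rank-two indices of `J ∖ {t₁, t₂}` into one class; the dichotomy for two of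
them, `t₃, t₄`, forbids the third, `t₅`, to lie in their class.) -/
theorem false_of_sameClass_three (hm : 8 ≤ m) (hJ : F.J.card ≤ m + 3) {t1 t2 : ι} (h1 : t1 ∈ F.J)
    (h2 : t2 ∈ F.J) (hne : t1 ≠ t2) (hr1 : t1 ∉ F.R1) (hr2 : t2 ∉ F.R1)
    (hpar : ∃ a : k, pvec β t2 = a • pvec β t1) : False := by
  classical
  obtain ⟨-, hB2⟩ := sameClass_dichotomy F hI (by omega) hJ h1 h2 hne hr1 hr2 hpar
  -- the rank-two indices of K = J \ {t1, t2}
  let K2 : Finset ι := (F.J \ {t1, t2}) \ F.R1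
  have hsub : ({t1, t2} : Finset ι) ⊆ F.J := by
    intro t ht
    rcases Finset.mem_insert.1 ht with rfl | ht
    · exact h1
    · rwa [Finset.mem_singleton.1 ht]
  have hcol := F.colCount
  have hsd : (F.J \ F.R1).card = F.J.card - F.R1.card := card_sdiff_of_subset F.R1_subset
  have hR1le : F.R1.card ≤ F.J.card := card_le_card F.R1_subset
  have hmJ : m ≤ F.J.card := F.le_card_J
  have hK2card : 3 ≤ K2.card := by
    have hK : (F.J \ {t1, t2}).card = F.J.card - 2 := by
      rw [Finset.card_sdiff_of_subset hsub, Finset.card_pair hne]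
    have hR1K : F.R1 ⊆ F.J \ {t1, t2} := by
      intro t ht
      refine Finset.mem_sdiff.2 ⟨F.R1_subset ht, ?_⟩
      simp only [Finset.mem_insert, Finset.mem_singleton, not_or]
      exact ⟨fun h => hr1 (h ▸ ht), fun h => hr2 (h ▸ ht)⟩
    have : K2.card = (F.J \ {t1, t2}).card - F.R1.card := Finset.card_sdiff_of_subset hR1K
    omega
  -- three distinct rank-two indices t3, t4, t5 of K
  obtain ⟨t3, ht3, t4, ht4, t5, ht5, h34, h35, h45⟩ : ∃ t3 ∈ K2, ∃ t4 ∈ K2, ∃ t5 ∈ K2,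
      t3 ≠ t4 ∧ t3 ≠ t5 ∧ t4 ≠ t5 := by
    obtain ⟨S, hS, hS3⟩ := Finset.exists_subset_card_eq hK2card
    obtain ⟨a, b, c, hab, hac, hbc, rfl⟩ := Finset.card_eq_three.1 hS3
    exact ⟨a, hS (by simp), b, hS (by simp), c, hS (by simp), hab, hac, hbc⟩
  have hK3 := (Finset.mem_sdiff.1 ht3); have hK4 := (Finset.mem_sdiff.1 ht4); have hK5 := (Finset.mem_sdiff.1 ht5)
  have hJ3 : t3 ∈ F.J := (Finset.mem_sdiff.1 hK3.1).1
  have hJ4 : t4 ∈ F.J := (Finset.mem_sdiff.1 hK4.1).1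
  have hJ5 : t5 ∈ F.J := (Finset.mem_sdiff.1 hK5.1).1
  have hp43 : ∃ a : k, pvec β t4 = a • pvec β t3 := hB2 t3 hK3.1 t4 hK4.1 hK3.2 hK4.2
  have hp53 : ∃ a : k, pvec β t5 = a • pvec β t3 := hB2 t3 hK3.1 t5 hK5.1 hK3.2 hK5.2
  obtain ⟨hB1', -⟩ := sameClass_dichotomy F hI (by omega) hJ hJ3 hJ4 h34 hK3.2 hK4.2 hp43
  exact hB1' t5 hJ5 (Ne.symm h35) (Ne.symm h45) (F.pvec_ne_zero_of_not_mem_R1 hJ5 hK5.2) hp53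

end Frame3m3

end Summit.MatrixMultiplication.OmegaCensus.SmallFormats
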